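import Mathlib.GroupTheory.FreeGroup.NielsenSchreier
import Literature.AnabelianGeometry.SemiGraphs.FundamentalGroup
import Literature.GroupTheory.CombinatorialGroupTheory.FreeGroupoidWords
import Literature.GroupTheory.CombinatorialGroupTheory.VirtuallyFreeResiduallyFinite
import HarnessLib

/-!
# The fundamental group of a semi-graph is free and residually finite ([SemiAnbd] §1, §3 p. 38–39)

Proof-only companion to `FundamentalGroup.lean` (abc-iut cell, layer L3; support for G10 rung 2 =
[SemiAnbd] Prop. 3.6 (iii)).  Mochizuki, *Semi-graphs of anabelioids*, Publ. RIMS 42 (2006):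
p. 20 "the fundamental group of any graph is free [cf. [Serre1], I, §3, Proposition 15; [Serre1],
I, §4.1, Theorem 4]" and p. 39 (proof of Prop. 3.6 (iii)) "the groups `Gal(H'_i/G)` [extensions of
finite groups by such fundamental groups] are residually finite".  In L3-t1's model
(`π₁(𝔾, c)` = vertex group of Mathlib's free groupoid on `catQuiver 𝔾`) both facts follow, for an
ARBITRARY semi-graph `𝔾` and ANY base component `c` (no connectedness or finiteness needed), from
the faithful word functor of `FreeGroupoidWords.lean` (Stallings Prop. 5.2): `π₁(𝔾, c)` embeds into
the free group on all arrows of `Cat(𝔾)`, hence is free (Nielsen–Schreier, Mathlib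
`subgroupIsFreeOfIsFree`) and residually finite (`freeGroup_residuallyFinite`).
-/

namespace Literature.AnabelianGeometry.SemiGraphs

namespace SemiGraph

open CategoryTheory
open Literature.GroupTheory.CombinatorialGroupTheory
open Literature.GroupTheory.CombinatorialGroupTheory.FreeGroupoidWords

universe u

variable (G : SemiGraph.{u}) (c : G.CatCarrier)

/-- **`π₁(𝔾, c)` embeds into a free group**: `x ↦ (W x)⁻¹`, `W` the (anti-multiplicative on the
vertex group) word functor to the free group on the arrows of `Cat(𝔾)`, is an injective
homomorphism. [cite: MochizukiSemiAnbd2006, §1 p.20] -/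
theorem exists_injective_hom_freeGroup :
    ∃ f : G.FundamentalGroup c →* FreeGroup (Letter G.CatCarrier), Function.Injective f := by
  let W := wordFunctor G.CatCarrier
  -- the word of a loop, as an element of the free group (the hom-type of `SingleObj` IS the group)
  let w : G.FundamentalGroup c → FreeGroup (Letter G.CatCarrier) := fun x => W.map x
  have hone : w (𝟙 (G.basept c)) = 1 := (W.map_id _).trans (SingleObj.id_as_one _ _)
  have hmul : ∀ x y : G.FundamentalGroup c, w (x ≫ y) = w y * w x := fun x y =>
    (W.map_comp x y).trans (SingleObj.comp_as_mul _ _ _)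
  have hinj : Function.Injective w := fun x y hxy =>
    wordFunctor_map_injective (V := G.CatCarrier) (X := c) (Y := c) hxy
  refine ⟨{ toFun := fun x => (w x)⁻¹
            map_one' := by change (w (𝟙 (G.basept c)))⁻¹ = 1; rw [hone, inv_one]
            map_mul' := fun x y => by change (w (x ≫ y))⁻¹ = (w x)⁻¹ * (w y)⁻¹; rw [hmul, mul_inv_rev] },
    fun x y hxy => hinj (inv_injective hxy)⟩

/-- **The fundamental group of a semi-graph is free** (p. 20: "the fundamental group of any graph
is free"), for any semi-graph and any base component. [cite: MochizukiSemiAnbd2006, Cor. 1.6 p.20] -/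
theorem isFreeGroup_fundamentalGroup : IsFreeGroup (G.FundamentalGroup c) := by
  obtain ⟨f, hf⟩ := exists_injective_hom_freeGroup G c
  exact IsFreeGroup.ofMulEquiv (MonoidHom.ofInjective hf).symm

/-- **The fundamental group of a semi-graph is residually finite** (used on p. 39, proof of
Prop. 3.6 (iii)). [cite: MochizukiSemiAnbd2006, Prop 3.6(iii) p.39] -/
theorem residuallyFinite_fundamentalGroup : Group.ResiduallyFinite (G.FundamentalGroup c) := by
  obtain ⟨f, hf⟩ := exists_injective_hom_freeGroup G c
  haveI := freeGroup_residuallyFinite (Letter G.CatCarrier)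
  exact residuallyFinite_of_injective f hf

end SemiGraph

end Literature.AnabelianGeometry.SemiGraphs
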